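import Mathlib
import Literature.Analysis.ValidatedNumerics.TaylorModelZeroCert
import Literature.Analysis.ValidatedNumerics.TaylorModelIntegralCertFamily
import Literature.MathematicalPhysics.MHD.BallooningSAlpha
import Summits.Ventures.FusionMHD.Models.SAlphaPolyWitnessS3A19Defs
import HarnessLib

/-!
# Data of the SECOND α-END `(s, α) = (3, 26/5)` of the `(3, 19/10)` witness (same trial function `SAlphaPolyWitnessS3A19.UX`) on the rational window `[−8, 8]`: the straight-line program of the `s–α` energy density (definitions only)

LADDER-GRIDFUSION rung F3 (cell `gridfusion`; «F3.BALLOON-sα-S3-A19-A52-BAND»); gridfusion-model-7 g9, 2026-08-28.  model-7's POLY-WITNESS LANE (g8, ★ #231 `SAlphaPolyWitnessS2A125*`) for the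
unstable side of the `s–α` MODEL at rational windows: instead of a closed form in `ℚ[π]` (★ #184 / ★ #192), the one-surface energy
`∫ [(1+Λ²)X′² − α(Λ sin θ + cos θ)X²] dθ` of an explicit polynomial trial function is ENCLOSED by the tree's kernel-checked Taylor-model
integral certificates (`Literature/Analysis/ValidatedNumerics/TaylorModelIntegralCertTrig`: `panelCheckT` / `fsegOK_of_panelCheckT`,
`FSegOK.append`, `FSegOK.bounds` — Mahboubi–Melquiond–Sibut-Pinote panels, Joldeş `sin`/`cos` models).  THE TRIAL FUNCTION: the float
Rayleigh–Ritz minimiser of the energy in the even family `(1 − θ²/64)·Σ_{k ≤ 16} c_k T_{2k}(θ/8)` at `(s, α) = (3, 26/5)`, coefficients rounded to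
dyadic rationals and expanded EXACTLY in powers of `θ` (design script `HOME/models/model-7/g8/unst/udesign2.py`; VALIDATED bookkeeping —
float energy `≈ -0.2415` with `X(0) ≈ 1`; every inequality used downstream is re-decided in the kernel).  THE PROGRAM `pw3bProg lx lxd` (22
statements): top register PROVED `= energyDensity 3 (26/5) (Poly.eval lx) (Poly.eval lxd)` in the first panel file.  MODELLED: `s–α` model; nothing
about a device.  Citations: Freidberg 2014 §12.3 (12.38), §12.6.2 (12.97) [Freidberg2014]; Mahboubi–Melquiond–Sibut-Pinote 2016 §3–4
[MahboubiMelquiondSibutpinote2016]; Makino–Berz 2003 [MakinoBerz2003].  Everything here is [instance data].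
-/

open MeasureTheory
open Literature.Analysis.ValidatedNumerics Literature.Analysis.ValidatedNumerics.PolyMP
open Literature.Analysis.ValidatedNumerics.NumericsMP Literature.Analysis.ValidatedNumerics.ExpPoly
open Literature.MathematicalPhysics.MHD.Ballooning
open Real Set

namespace Summit.Ventures.FusionMHD.Models

namespace SAlphaPolyWitnessS3A52

/-- THE PROGRAM of the `s–α` energy DENSITY `(1+Λ²)X′² − α(Λ sin t + cos t)X²` at `(s, α) = (3, 26/5)` for `X = Poly.eval lx`,
`X′ = Poly.eval lxd` (22 statements; registers `t, sin t, cos t, −α sin t, s t, Λ, Λ², 1+Λ², Λ sin t + cos t, drive, X, X′, …`). [instance data] -/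
def pw3bProg (lx lxd : Poly) : TProg :=
  [ TOp.base (SOp.poly [0, 1]), TOp.sin 0, TOp.cos 1, TOp.base (SOp.poly [-26/5]), TOp.base (SOp.mul 0 2),
    TOp.base (SOp.poly [0, 3]), TOp.base (SOp.add 0 1), TOp.base (SOp.mul 0 0), TOp.base (SOp.poly [1]), TOp.base (SOp.add 0 1),
    TOp.base (SOp.mul 3 8), TOp.base (SOp.add 0 8), TOp.base (SOp.poly [26/5]), TOp.base (SOp.mul 0 1),
    TOp.base (SOp.poly lx), TOp.base (SOp.poly lxd), TOp.base (SOp.mul 0 0), TOp.base (SOp.mul 7 0),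
    TOp.base (SOp.mul 3 3), TOp.base (SOp.mul 5 0), TOp.base (SOp.neg 0), TOp.base (SOp.add 3 0) ]

/-! The trial function is `SAlphaPolyWitnessS3A19.UX` / `UXd` BY NAME (aliases exported into this namespace; nothing re-declared). -/
export Summit.Ventures.FusionMHD.Models.SAlphaPolyWitnessS3A19 (UX UXd)

end SAlphaPolyWitnessS3A52

end Summit.Ventures.FusionMHD.Models
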